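import Summits.BirchSwinnertonDyer.BirchSwinnertonDyer.Theorems.SignedBaseChangeAnticyclotomicEisensteinDivisibilityAdmdefCoreConnectedSplit
import Summits.BirchSwinnertonDyer.BirchSwinnertonDyer.Theorems.SignedBaseChangeAnticyclotomicEisensteinDivisibilityAdmdefZeroVertexDictionary
import Summits.BirchSwinnertonDyer.BirchSwinnertonDyer.Theorems.SignedBaseChangeAnticyclotomicEisensteinDivisibilityAdmdefHowardEdges
import Summits.BirchSwinnertonDyer.BirchSwinnertonDyer.Theorems.SignedBaseChangeAnticyclotomicEisensteinDivisibilityAdmdefBipartiteNVLevelOne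
import HarnessLib

/-!
# Line `admdef` (crux `AnticyclotomicEisensteinDivisibility`, stmt-BirchSwinnertonDyer-20727): HOWARD'S RIGIDITY THEOREM (Crelle 2006, Thm. 2.5.1 ∕
# Thm. 3.2.3 (b)–(c)) modulo `𝔪 = (p, T)` for CHKLL25's signed bipartite system ON CELL β, at EVERY vertex — «[NV] ⟹ `λ_1(n)(0) ∈ ℤ_pˣ` at every odd
# zero vertex and `κ_1(n)_0 ≠ 0` at every even rank-one vertex of W. Zhang's level-raised Selmer walk» — the rigidity road CLOSED modulo three named
# print facts (Poitou–Tate duality for Selmer structures; Hatley–Lei–Vigni 2022 Lemma 3.7, local form; Dokchitser–Dokchitser 2010 §4.6 step (4))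

LEAD seat bsd-line-sbc-p1 (gen 32), `--supports stmt-BirchSwinnertonDyer-20727` (helper; OFF the v24 composition path; the END of the rigidity road of
`Lines/admdef-lead-g25.md` §4 … `-g31.md` §3).  Assembly of LEAD g32's four inputs: Howard Prop. 2.4.11 on β (`…AdmdefCoreConnectedSplit`: the core graph
of the canonical spaces `SelQP W K p c` is connected, modulo `poitouTate_selmerStructure_duality K` and odd bottom rank), the zero-vertex dictionary
(`…AdmdefZeroVertexDictionary`: `SelQP s ± = ⊥ ⟺ Sel^ε_{∏s}(K_0, E[p]) = 0`, modulo {HLV 2022 Lemma 3.7 local} on the all-ramified cell), the two edge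
lemmas (`…AdmdefHowardEdges`), and the seed supplied by [NV] (`B.HasUnitLambda N ⟺ ∃ m ∈ 𝒩_1^def, λ_1(m)(0) ∈ ℤ_pˣ`, g14) made a CORE vertex by Howard's
vanishing lemma (`…AdmdefHowardVanishing`, g28).

* §1 levels ↔ products: `∏_{q ∈ s} q ∈ 𝒩_1^ind ∕ 𝒩_1^def` by the parity of `#s`; every `m ∈ 𝒩_1^def` is such a product; `∏ (insert q s) = (∏ s)·q`, `q ∤ ∏ s`.
* §2 `propagate` — along `Relation.EqvGen` of Howard's core-edge relation (AKR currency: «`b = a ∪ {q}`, the odd end has `SelQP ± = ⊥`») the predicate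
  «`κ_1(∏a)_0 ≠ 0` if `#a` is even, `λ_1(∏a)(0) ∈ ℤ_pˣ` if `#a` is odd» is INVARIANT (edge lemmas + zero-vertex dictionary).
* §3 ★★★ `isUnit_lam_of_hasUnitLambda_of_selQP_eq_bot` — **[NV] ⟹ `λ_1(∏s)(0) ∈ ℤ_pˣ` at EVERY odd zero vertex `s`** (exactly the vertices at which the
  anchor (K1, item stmt-BirchSwinnertonDyer-33118) is asked, in its own currency `∀ μ, AdditiveKoly.SelQP W K p c s μ = ⊥`); ★★★
  `kappa_ne_zero_of_hasUnitLambda_of_rank_one` — **[NV] ⟹ `κ_1(∏s)_0 ≠ 0` at EVERY even vertex of total canonical rank one**; ★★★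
  `isUnit_lam_iff_selQP_eq_bot_of_hasUnitLambda` — Thm 3.2.3 (c) AS AN IFF at every definite vertex given [NV] («λ unit ⟺ zero vertex»); and the `_of_dokchitser`
  forms with the odd bottom rank discharged (tree Cassels–Tate + DD10 named fact).  CONSEQUENCE FOR THE LINE: on cell β the research statement K1
  («non-zero weighted toric period at EVERY odd zero vertex», λ-currency through the bridge cites (15)–(16)) and [NV] («… at ONE definite vertex») are
  EQUIVALENT modulo the three named print facts — the anchor's content is Howard's non-triviality hypothesis, no more.

Hypotheses of §3 (all displayed): the signed system `hB` (CHKLL25 Thm. 7.4 shape), `AcSigned.Setting` (`p` odd good supersingular, `a_p = 0`, `K` imaginary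
quadratic, `p` split, `κ` anticyclotomic, `p ∤ h_K`), {HLV 3.7 local}, `(N : ℤ) = N_E`, `p ≥ 5`, `ρ̄` onto, (Heeg), `p` split as `ncard = 2`, `(N, d_K) = 1`,
binder (ii) all-ramified, the PT fact, `c ≠ 1`, odd `dim Sel_∅⁺ + dim Sel_∅⁻` (or the DD10 fact), [NV].  HONEST FRAMING: theorems only (0 definitions, 0 named
facts introduced, 0 `sorry`; standard axioms); CONDITIONAL on the three named print facts (audit `proof.conditional`); [NV] is a HYPOTHESIS — nothing here
proves [NV], K1, the crux or BSD; no summit statement is proved.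

References: [cite: Howard2006Bipartite, Lemma 2.3.3, Cor. 2.3.5, Lemma 2.4.9, Lemma 2.4.10, Prop. 2.4.11, Cor. 2.4.12, Thm. 2.5.1, Thm. 3.2.3] [cite: CastellaEtAl2025, Thm. 7.4, Thm. 7.5, §7.4 (arXiv:2308.10474v2 pp. 30–33)]
[cite: WZhang2014, Lemma 5.3, Prop. 5.4, Thm. 7.2, Lemma 7.3, §9] [cite: BertoliniDarmon2005, Thm. 3.2, Thm. 4.1, Thm. 4.2] [cite: MilneADT2006, Ch. I, Thm. 4.10]
[cite: HatleyLeiVigni2022, Lemma 3.7] [cite: DokchitserDokchitserAnnals2010, §4.6, Thm. 4.19]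
-/

-- D-0017: single-problem summit, the namespace repeats the problem name by design.
set_option linter.dupNamespace false
set_option autoImplicit false

noncomputable section

open scoped Classical NumberField Pointwise

namespace Summit.BirchSwinnertonDyer.BirchSwinnertonDyer.Theorems.SignedBaseChangeAcDivAdmdefHowardRigidity

open CategoryTheory WeierstrassCurve NumberField IsDedekindDomain Field Module
open Literature.NumberTheory.EllipticCurves Literature.NumberTheory.GaloisRepresentations Literature.NumberTheory.GaloisCohomology
open Literature.NumberTheory.EllipticCurves.CastellaHsuKunduLeeLiu2025
open Literature.NumberTheory.EllipticCurves.BertoliniDarmon2005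
open Literature.NumberTheory.EllipticCurves.AcSigned
open Literature.NumberTheory.EllipticCurves.Rank1Residual
open Summit.BirchSwinnertonDyer.BirchSwinnertonDyer.Theorems.AdditiveKoly
open Summit.BirchSwinnertonDyer.Rank1Residual.X11b.Three.Koly.Method2
open Summit.BirchSwinnertonDyer.BirchSwinnertonDyer.Theorems.SignedBaseChangeAcDivAdmdefSelmerBookkeeping
open Summit.BirchSwinnertonDyer.BirchSwinnertonDyer.Theorems.SignedBaseChangeAcDivAdmdefHowardVanishing
open Summit.BirchSwinnertonDyer.BirchSwinnertonDyer.Theorems.SignedBaseChangeAcDivAdmdefKolyvaginVertex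
open Summit.BirchSwinnertonDyer.BirchSwinnertonDyer.Theorems.SignedBaseChangeAcDivAdmdefRamifiedBaseChange
open Summit.BirchSwinnertonDyer.BirchSwinnertonDyer.Theorems.SignedBaseChangeAcDivAdmdefSignedControl
open Summit.BirchSwinnertonDyer.BirchSwinnertonDyer.Theorems.SignedBaseChangeAcDivAdmdefBipartiteNVLevelOne
open Summit.BirchSwinnertonDyer.BirchSwinnertonDyer.Theorems.SignedBaseChangeAcDivAdmdefCoreConnectedSplit
open Summit.BirchSwinnertonDyer.BirchSwinnertonDyer.Theorems.SignedBaseChangeAcDivAdmdefZeroVertexDictionary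
open Summit.BirchSwinnertonDyer.BirchSwinnertonDyer.Theorems.SignedBaseChangeAcDivAdmdefHowardEdges
open scoped ContRepresentation

universe u

/-! ## §1 Levels (finite sets of admissible primes) and products (`𝒩_1^ind ∕ 𝒩_1^def`) -/

section Levels

variable {K : Type} [Field K] [NumberField K] {W : WeierstrassCurve ℚ} [W.IsGloballyMinimal] {p : ℕ} [Fact p.Prime]

omit [NumberField K] [Fact p.Prime] in
/-- `∏_{q ∈ insert q s} q = (∏_{q ∈ s} q) · q` for `q ∉ s`. [folklore] -/
theorem prod_insert_eq_mul {s : Finset (AdmQ W K p)} {q : AdmQ W K p} (hqs : q ∉ s) :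
    (∏ r ∈ insert q s, (r : ℕ)) = (∏ r ∈ s, (r : ℕ)) * (q : ℕ) := by
  rw [Finset.prod_insert hqs, mul_comm]

omit [NumberField K] [Fact p.Prime] in
/-- `q ∤ ∏_{r ∈ s} r` for an admissible `q ∉ s` (distinct primes). [folklore] -/
theorem not_dvd_prod_of_notMem {s : Finset (AdmQ W K p)} {q : AdmQ W K p} (hqs : q ∉ s) : ¬ (q : ℕ) ∣ ∏ r ∈ s, (r : ℕ) := by
  intro hdvd
  obtain ⟨r, hr, hqr⟩ := (Nat.Prime.prime q.2.prime).exists_mem_finset_dvd hdvd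
  have heq : (q : ℕ) = (r : ℕ) := (Nat.prime_dvd_prime_iff_eq q.2.prime r.2.prime).mp hqr
  exact hqs (Subtype.ext heq ▸ hr)

omit [NumberField K] [Fact p.Prime] in
/-- The product of a finite set of admissible primes lies in `𝒩_1` (at the level `N = N_E` of `B`). [cite: CastellaEtAl2025, §7.2 (arXiv:2308.10474v2 p0030 L1–L6)] -/
theorem prod_mem_admissibleProducts {N : ℕ} (hN : (N : ℤ) = W.conductorNorm ℤ) (s : Finset (AdmQ W K p)) :
    (∏ r ∈ s, (r : ℕ)) ∈ admissibleProducts N K (fun ℓ ↦ W.frobeniusTrace ℓ) p 1 := by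
  have hN' : N = W.conductorNorm ℤ := by exact_mod_cast hN
  refine ⟨?_, fun ℓ hℓ hℓs ↦ ?_⟩
  · refine Finset.squarefree_prod_of_pairwise_isCoprime ?_ fun r _ ↦ r.2.prime.prime.squarefree
    intro r _ r' _ hrr'
    have hne : (r : ℕ) ≠ (r' : ℕ) := fun h ↦ hrr' (Subtype.ext h)
    exact Nat.coprime_iff_isRelPrime.mp ((Nat.coprime_primes r.2.prime r'.2.prime).mpr hne)
  · obtain ⟨r, hr, hℓr⟩ := (Nat.Prime.prime hℓ).exists_mem_finset_dvd hℓs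
    rw [(Nat.prime_dvd_prime_iff_eq hℓ r.2.prime).mp hℓr, hN']
    exact r.2

omit [NumberField K] [Fact p.Prime] in
/-- The prime factors of `∏_{r ∈ s} r` are `s` (as naturals), so their number is `#s`. [folklore] -/
theorem card_primeFactors_prod (s : Finset (AdmQ W K p)) : (∏ r ∈ s, (r : ℕ)).primeFactors.card = s.card := by
  have h : ∏ x ∈ s.image Subtype.val, x = ∏ r ∈ s, (r : ℕ) :=
    Finset.prod_image fun x _ y _ hxy ↦ Subtype.ext hxy
  rw [← h, Nat.primeFactors_prod fun x hx ↦ ?_, Finset.card_image_of_injective _ Subtype.val_injective]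
  obtain ⟨r, -, rfl⟩ := Finset.mem_image.mp hx
  exact r.2.prime

omit [NumberField K] [Fact p.Prime] in
/-- An EVEN level gives an indefinite vertex: `∏ s ∈ 𝒩_1^ind`. [cite: Howard2006, Def. 3.2.1] -/
theorem prod_mem_indefProducts_of_even {N : ℕ} (hN : (N : ℤ) = W.conductorNorm ℤ) {s : Finset (AdmQ W K p)} (hs : Even s.card) :
    (∏ r ∈ s, (r : ℕ)) ∈ indefProducts N K (fun ℓ ↦ W.frobeniusTrace ℓ) p 1 :=
  ⟨prod_mem_admissibleProducts hN s, by rw [card_primeFactors_prod]; exact hs⟩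

omit [NumberField K] [Fact p.Prime] in
/-- An ODD level gives a definite vertex: `∏ s ∈ 𝒩_1^def`. [cite: Howard2006, Def. 3.2.1] -/
theorem prod_mem_defProducts_of_odd {N : ℕ} (hN : (N : ℤ) = W.conductorNorm ℤ) {s : Finset (AdmQ W K p)} (hs : Odd s.card) :
    (∏ r ∈ s, (r : ℕ)) ∈ defProducts N K (fun ℓ ↦ W.frobeniusTrace ℓ) p 1 :=
  ⟨prod_mem_admissibleProducts hN s, by rw [card_primeFactors_prod]; exact hs⟩

omit [NumberField K] [Fact p.Prime] in
/-- Every `m ∈ 𝒩_1^def` is the product of an odd level (its set of prime factors). [cite: WZhang2014, Notations (xiv)] -/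
theorem exists_level_of_mem_defProducts {N : ℕ} (hN : (N : ℤ) = W.conductorNorm ℤ) {m : ℕ}
    (hm : m ∈ defProducts N K (fun ℓ ↦ W.frobeniusTrace ℓ) p 1) :
    ∃ s : Finset (AdmQ W K p), Odd s.card ∧ (∏ r ∈ s, (r : ℕ)) = m := by
  have hN' : N = W.conductorNorm ℤ := by exact_mod_cast hN
  obtain ⟨hadm, hodd, hprod⟩ := isZhangAdmissibleLevel_primeFactors_of_mem hm
  have hadm' : ∀ x ∈ m.primeFactors, IsAdmissiblePrime (W.conductorNorm ℤ) K (fun ℓ ↦ W.frobeniusTrace ℓ) p 1 x :=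
    fun x hx ↦ hN' ▸ hadm x hx
  set s : Finset (AdmQ W K p) :=
    m.primeFactors.subtype (fun x ↦ IsAdmissiblePrime (W.conductorNorm ℤ) K (fun ℓ ↦ W.frobeniusTrace ℓ) p 1 x) with hsdef
  have hmap : s.map (Function.Embedding.subtype _) = m.primeFactors := by
    rw [hsdef, Finset.subtype_map, Finset.filter_true_of_mem hadm']
  refine ⟨s, ?_, ?_⟩
  · rw [← Finset.card_map (Function.Embedding.subtype _), hmap]; exact hodd
  · have h : (∏ r ∈ s, (r : ℕ)) = ∏ x ∈ s.map (Function.Embedding.subtype _), x := by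
      rw [Finset.prod_map]; rfl
    rw [h, hmap, hprod]

end Levels

/-! ## §2 Propagation of «`κ ≠ 0` ∕ `λ` unit» along Howard's core edges (AKR currency for the vertices, CHKLL currency for the system) -/

section Propagate

variable {K : Type} [Field K] [NumberField K] {W : WeierstrassCurve ℚ} [W.IsElliptic] [W.IsGloballyMinimal] {p : ℕ} [Fact p.Prime]
  {κ : ZpExtension K p} {γ : absoluteGaloisGroup K} {N : ℕ} {ε : ℤˣ} {B : SignedBipartiteSystem W K p κ} {𝔭 𝔭' : HeightOneSpectrum (𝓞 K)}
  (c : K ≃ₐ[ℚ] K) [Module (ZMod p) (Vp W K p)]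

/-- **PROPAGATION (Howard 2006, Cor. 2.4.12 over the residue field).**  Along the equivalence closure of Howard's core-edge relation «`b = a ∪ {q}`, `q ∉ a`, and
the ODD endpoint is a zero vertex (`SelQP ± = ⊥`)» the predicate «`κ_1(∏a)_0 ≠ 0` if `#a` is even, `λ_1(∏a)(0) ∈ ℤ_pˣ` if `#a` is odd» is invariant:
one edge is `…AdmdefHowardEdges.isUnit_lam_mul_iff_kappa_ne_zero` (even end below) or `isUnit_lam_iff_kappa_mul_ne_zero` (odd end below), the odd end's
AKR zero condition being converted to `Sel^ε = 0` by `…AdmdefZeroVertexDictionary.forall_eq_zero_of_selQP_eq_bot` (cell β, {HLV 3.7 local}).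
[cite: Howard2006Bipartite, Cor. 2.3.5, Cor. 2.4.12, Thm. 2.5.1] [cite: CastellaEtAl2025, Thm. 7.4] -/
theorem propagate (hB : IsSignedBipartiteSystem W K p κ γ N ε B) (hS : Setting W K p κ 𝔭 𝔭')
    (hH : SatisfiesHeegnerHypothesis (W.conductorNorm ℤ) K) (hloc : hatleyLeiVigni2022_lemma37_local_signedCondition_eq_kummer W K p κ 𝔭 𝔭')
    (h5 : 5 ≤ p) (hN : (N : ℤ) = W.conductorNorm ℤ) (hND : IsCoprime (N : ℤ) (NumberField.discr K))
    (hall : ∀ q : ℕ, q.Prime → q ∣ N → ∃ v' : HeightOneSpectrum (𝓞 ℚ), ((q : ℕ) : 𝓞 ℚ) ∈ v'.asIdeal ∧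
      ∃ 𝔓 ∈ v'.primesAbove, ∃ σ ∈ 𝔓.inertia (absoluteGaloisGroup ℚ), ∃ P : W.geomTorsion (p : ℤ), σ • P ≠ P)
    (hc1 : c ≠ 1) {a b : Finset (AdmQ W K p)}
    (h : Relation.EqvGen (fun a b : Finset (AdmQ W K p) ↦ ∃ q, q ∉ a ∧ b = insert q a ∧
        (Even a.card → SelQP W K p c (insert q a) true = ⊥ ∧ SelQP W K p c (insert q a) false = ⊥) ∧
        (Odd a.card → SelQP W K p c a true = ⊥ ∧ SelQP W K p c a false = ⊥)) a b) :
    ((Even a.card → B.kappa 1 (∏ r ∈ a, (r : ℕ)) 0 ≠ 0) ∧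
        (Odd a.card → IsUnit (PowerSeries.constantCoeff (B.lam 1 (∏ r ∈ a, (r : ℕ)))))) ↔
      ((Even b.card → B.kappa 1 (∏ r ∈ b, (r : ℕ)) 0 ≠ 0) ∧
        (Odd b.card → IsUnit (PowerSeries.constantCoeff (B.lam 1 (∏ r ∈ b, (r : ℕ)))))) := by
  -- adapted from Theorems/AdditiveKolyvaginRoadLevelSystemsRigidityCore.lean `CoreGraph.propagate_of_eqvGen` (the B-currency edge lemmas plugged in)
  have hK := hS.isImaginaryQuadratic
  have hκ := hS.anticyclotomic
  have hN' : N = W.conductorNorm ℤ := by exact_mod_cast hN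
  have hzeroOf : ∀ {s : Finset (AdmQ W K p)}, (SelQP W K p c s true = ⊥ ∧ SelQP W K p c s false = ⊥) →
      ∀ x ∈ signedOrdSelmerTorsion (W.baseChange K) p κ ε (∏ r ∈ s, (r : ℕ)) 0 1, x = 0 := by
    intro s hs
    refine forall_eq_zero_of_selQP_eq_bot W κ c hS hH hloc h5 hN hND hall hc1 ε fun μ ↦ ?_
    cases μ
    · exact hs.2
    · exact hs.1
  induction h with
  | rel x y hxy =>
    obtain ⟨q, hqx, rfl, hev, hod⟩ := hxy
    have hqadm : IsAdmissiblePrime N K (fun ℓ ↦ W.frobeniusTrace ℓ) p 1 q := hN' ▸ q.2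
    have hqx' : ¬ (q : ℕ) ∣ ∏ r ∈ x, (r : ℕ) := not_dvd_prod_of_notMem hqx
    have hcard : (insert q x).card = x.card + 1 := Finset.card_insert_of_notMem hqx
    rcases Nat.even_or_odd x.card with hx | hx
    · -- `x` even below the odd zero vertex `x ∪ {q}`: EDGE UP
      have hy : Odd (insert q x).card := by rw [hcard]; exact hx.add_one
      have hzero := hzeroOf (hev hx)
      rw [prod_insert_eq_mul hqx] at hzero
      have key := isUnit_lam_mul_iff_kappa_ne_zero hB hN hK hκ (prod_mem_indefProducts_of_even hN hx) hqadm hqx' hzero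
      rw [prod_insert_eq_mul hqx]
      exact ⟨fun hP ↦ ⟨fun he ↦ absurd he (Nat.not_even_iff_odd.mpr hy), fun _ ↦ key.mpr (hP.1 hx)⟩,
        fun hP ↦ ⟨fun _ ↦ key.mp (hP.2 hy), fun ho ↦ absurd ho (Nat.not_odd_iff_even.mpr hx)⟩⟩
    · -- `x` odd zero vertex below the even vertex `x ∪ {q}`: EDGE DOWN
      have hy : Even (insert q x).card := by rw [hcard]; exact hx.add_one
      have hzero := hzeroOf (hod hx)
      have key := isUnit_lam_iff_kappa_mul_ne_zero hB hN hK hκ (prod_mem_defProducts_of_odd hN hx) hqadm hqx' hzero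
      rw [prod_insert_eq_mul hqx]
      exact ⟨fun hP ↦ ⟨fun _ ↦ key.mp (hP.2 hx), fun ho ↦ absurd ho (Nat.not_odd_iff_even.mpr hy)⟩,
        fun hP ↦ ⟨fun he ↦ absurd he (Nat.not_even_iff_odd.mpr hx), fun _ ↦ key.mpr (hP.1 hy)⟩⟩
  | refl x => exact Iff.rfl
  | symm x y _ ih => exact ih.symm
  | trans x y z _ _ ih₁ ih₂ => exact ih₁.trans ih₂

end Propagate

/-! ## §3 HOWARD'S RIGIDITY THEOREM mod 𝔪 on cell β: [NV] ⟹ non-vanishing at EVERY core vertex -/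

section Main

variable {K : Type} [Field K] [NumberField K] {W : WeierstrassCurve ℚ} [W.IsElliptic] [W.IsGloballyMinimal] {p : ℕ} [Fact p.Prime]
  {κ : ZpExtension K p} {γ : absoluteGaloisGroup K} {N : ℕ} {ε : ℤˣ} {B : SignedBipartiteSystem W K p κ} {𝔭 𝔭' : HeightOneSpectrum (𝓞 K)}
  (c : K ≃ₐ[ℚ] K) [Module (ZMod p) (Vp W K p)]

/-- **[NV] supplies a CORE seed**: a definite vertex `m₀ ∈ 𝒩_1^def` with `λ_1(m₀)(0) ∈ ℤ_pˣ` (g14's `hasUnitLambda_iff_level_one`) is an odd level `n₀`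
(§1) which is an AKR zero vertex — Howard's vanishing lemma (`…AdmdefHowardVanishing`, (CTRL) := {HLV 3.7 local}, (RAM) := all-ramified) kills
`Sel^ε_{m₀}(K_0, E[p])`, and the zero-vertex dictionary converts. [cite: Howard2006Bipartite, Lem. 2.3.4, Thm. 3.2.3] [cite: CastellaEtAl2025, Thm. 7.5] -/
theorem exists_seed_of_hasUnitLambda (hB : IsSignedBipartiteSystem W K p κ γ N ε B) (hS : Setting W K p κ 𝔭 𝔭')
    (hloc : hatleyLeiVigni2022_lemma37_local_signedCondition_eq_kummer W K p κ 𝔭 𝔭')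
    (hN : (N : ℤ) = W.conductorNorm ℤ) (h5 : 5 ≤ p) (hsurj : W.HasSurjectiveModNGaloisRep p)
    (hH : SatisfiesHeegnerHypothesis (W.conductorNorm ℤ) K) (hsp : ((Ideal.span {(p : ℤ)}).primesOver (𝓞 K)).ncard = 2)
    (hND : IsCoprime (N : ℤ) (NumberField.discr K))
    (hall : ∀ q : ℕ, q.Prime → q ∣ N → ∃ v' : HeightOneSpectrum (𝓞 ℚ), ((q : ℕ) : 𝓞 ℚ) ∈ v'.asIdeal ∧
      ∃ 𝔓 ∈ v'.primesAbove, ∃ σ ∈ 𝔓.inertia (absoluteGaloisGroup ℚ), ∃ P : W.geomTorsion (p : ℤ), σ • P ≠ P)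
    (hNV : B.HasUnitLambda N) :
    ∃ n₀ : Finset (AdmQ W K p), Odd n₀.card ∧ IsUnit (PowerSeries.constantCoeff (B.lam 1 (∏ r ∈ n₀, (r : ℕ)))) ∧
      (∀ μ : Bool, SelQP W K p c n₀ μ = ⊥) := by
  obtain ⟨m₀, hm₀, hu₀⟩ := (hasUnitLambda_iff_level_one hB).mp hNV
  obtain ⟨n₀, hodd, hprod⟩ := exists_level_of_mem_defProducts (W := W) (K := K) (p := p) hN hm₀
  refine ⟨n₀, hodd, by rw [hprod]; exact hu₀, ?_⟩
  refine selQP_eq_bot_of_forall_eq_zero W κ c hS hH hloc h5 hN hND hall ε ?_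
  rw [hprod]
  exact eq_zero_of_mem_signedOrdSelmerTorsion_of_isUnit_lam hB hN h5 hsurj hS.isImaginaryQuadratic hH hsp hS.anticyclotomic
    (ctrl_of_lemma37_local W κ hS hH hloc ε)
    (forall_exists_inertia_smul_ne_baseChange_of_allRamified W hS.isImaginaryQuadratic.1 hN hND hall) hm₀ hu₀

/-- ★★★ **HOWARD'S THEOREM 3.2.3 (c) mod `𝔪` ON CELL β, AT EVERY DEFINITE VERTEX: [NV] ⟹ `λ_1(∏s)(0) ∈ ℤ_pˣ` at EVERY odd zero vertex `s`.**  For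
CHKLL25's signed bipartite system `B` of sign `ε` at level `N = N_E` over the anticyclotomic tower of the imaginary quadratic `K` (`AcSigned.Setting`: `p`
good supersingular, `a_p = 0`, split; `p ∤ h_K`), on the frame `p ≥ 5`, `ρ̄_{E,p}` onto, every `ℓ ∣ N` split, `(N, d_K) = 1`, binder (ii) «`E[p]` ramified at
every `q ∣ N`», GIVEN the named print facts `poitouTate_selmerStructure_duality K` and {Hatley–Lei–Vigni 2022 Lemma 3.7, local form}, `c ∈ Aut(K/ℚ)`
non-trivial, ODD `dim_𝔽p Sel_∅⁺ + dim_𝔽p Sel_∅⁻` ((Par)), and [NV] `B.HasUnitLambda N`: for every finite set `s` of Bertolini–Darmon admissible primes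
of ODD cardinality with `SelQP W K p c s ⁺ = SelQP W K p c s ⁻ = 0` (an odd ZERO VERTEX of the level-raised Selmer walk — the hypothesis of the anchor
K1), `λ_1(∏_{q∈s} q)(0)` is a unit of `ℤ_p`.  Proof: the seed `n₀` of [NV] and `s` are core vertices; Howard's core graph on β is connected
(`selQP_eqvGen_coreEdge_of_split_of_poitouTate`); propagate (§2).  [NV] is a HYPOTHESIS; nothing here proves it.
[cite: Howard2006Bipartite, Prop. 2.4.11, Cor. 2.4.12, Thm. 2.5.1] [cite: Howard2006, Thm. 3.2.3 (c)] [cite: CastellaEtAl2025, Thm. 7.4, Thm. 7.5, §7.4]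
[cite: WZhang2014, Thm. 9.1] [cite: MilneADT2006, Ch. I, Thm. 4.10] [cite: HatleyLeiVigni2022, Lemma 3.7] -/
theorem isUnit_lam_of_hasUnitLambda_of_selQP_eq_bot (hB : IsSignedBipartiteSystem W K p κ γ N ε B) (hS : Setting W K p κ 𝔭 𝔭')
    (hloc : hatleyLeiVigni2022_lemma37_local_signedCondition_eq_kummer W K p κ 𝔭 𝔭') (hPT : poitouTate_selmerStructure_duality K)
    (hN : (N : ℤ) = W.conductorNorm ℤ) (h5 : 5 ≤ p) (hsurj : W.HasSurjectiveModNGaloisRep p)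
    (hH : SatisfiesHeegnerHypothesis (W.conductorNorm ℤ) K) (hsp : ((Ideal.span {(p : ℤ)}).primesOver (𝓞 K)).ncard = 2)
    (hND : IsCoprime (N : ℤ) (NumberField.discr K))
    (hall : ∀ q : ℕ, q.Prime → q ∣ N → ∃ v' : HeightOneSpectrum (𝓞 ℚ), ((q : ℕ) : 𝓞 ℚ) ∈ v'.asIdeal ∧
      ∃ 𝔓 ∈ v'.primesAbove, ∃ σ ∈ 𝔓.inertia (absoluteGaloisGroup ℚ), ∃ P : W.geomTorsion (p : ℤ), σ • P ≠ P)
    (hc1 : c ≠ 1) (hodd : Odd (finrank (ZMod p) (SelQP W K p c ∅ true) + finrank (ZMod p) (SelQP W K p c ∅ false)))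
    (hNV : B.HasUnitLambda N)
    {s : Finset (AdmQ W K p)} (hs : Odd s.card) (hzero : ∀ μ : Bool, SelQP W K p c s μ = ⊥) :
    IsUnit (PowerSeries.constantCoeff (B.lam 1 (∏ r ∈ s, (r : ℕ)))) := by
  have hK := hS.isImaginaryQuadratic
  obtain ⟨n₀, hn₀odd, hu₀, hn₀zero⟩ := exists_seed_of_hasUnitLambda c hB hS hloc hN h5 hsurj hH hsp hND hall hNV
  have ha : finrank (ZMod p) (SelQP W K p c n₀ true) + finrank (ZMod p) (SelQP W K p c n₀ false) ≤ 1 := by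
    rw [hn₀zero true, hn₀zero false, finrank_bot]; omega
  have hb : finrank (ZMod p) (SelQP W K p c s true) + finrank (ZMod p) (SelQP W K p c s false) ≤ 1 := by
    rw [hzero true, hzero false, finrank_bot]; omega
  have hpath := selQP_eqvGen_coreEdge_of_split_of_poitouTate W K p c h5 hsurj hK hH hsp hc1 hPT hodd ha hb
  have hP := (propagate c hB hS hH hloc h5 hN hND hall hc1 hpath).mp
    ⟨fun he ↦ absurd he (Nat.not_even_iff_odd.mpr hn₀odd), fun _ ↦ hu₀⟩
  exact hP.2 hs

/-- ★★★ **HOWARD'S THEOREM 3.2.3 (b) mod `𝔪` ON CELL β, AT EVERY INDEFINITE VERTEX: [NV] ⟹ `κ_1(∏s)_0 ≠ 0` at EVERY even vertex `s` of total canonical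
rank one** (hypotheses as in `isUnit_lam_of_hasUnitLambda_of_selQP_eq_bot`; with g31's `…AdmdefKolyvaginVertex` the class then GENERATES
`Sel^ε_{∏s}(K_0, E[p])`).  [cite: Howard2006Bipartite, Prop. 2.4.11, Thm. 2.5.1] [cite: Howard2006, Thm. 3.2.3 (b)] [cite: CastellaEtAl2025, Thm. 7.4, Thm. 7.5]
[cite: WZhang2014, Thm. 9.1] [cite: MilneADT2006, Ch. I, Thm. 4.10] [cite: HatleyLeiVigni2022, Lemma 3.7] -/
theorem kappa_ne_zero_of_hasUnitLambda_of_rank_one (hB : IsSignedBipartiteSystem W K p κ γ N ε B) (hS : Setting W K p κ 𝔭 𝔭')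
    (hloc : hatleyLeiVigni2022_lemma37_local_signedCondition_eq_kummer W K p κ 𝔭 𝔭') (hPT : poitouTate_selmerStructure_duality K)
    (hN : (N : ℤ) = W.conductorNorm ℤ) (h5 : 5 ≤ p) (hsurj : W.HasSurjectiveModNGaloisRep p)
    (hH : SatisfiesHeegnerHypothesis (W.conductorNorm ℤ) K) (hsp : ((Ideal.span {(p : ℤ)}).primesOver (𝓞 K)).ncard = 2)
    (hND : IsCoprime (N : ℤ) (NumberField.discr K))
    (hall : ∀ q : ℕ, q.Prime → q ∣ N → ∃ v' : HeightOneSpectrum (𝓞 ℚ), ((q : ℕ) : 𝓞 ℚ) ∈ v'.asIdeal ∧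
      ∃ 𝔓 ∈ v'.primesAbove, ∃ σ ∈ 𝔓.inertia (absoluteGaloisGroup ℚ), ∃ P : W.geomTorsion (p : ℤ), σ • P ≠ P)
    (hc1 : c ≠ 1) (hodd : Odd (finrank (ZMod p) (SelQP W K p c ∅ true) + finrank (ZMod p) (SelQP W K p c ∅ false)))
    (hNV : B.HasUnitLambda N)
    {s : Finset (AdmQ W K p)} (hs : Even s.card)
    (hrank : finrank (ZMod p) (SelQP W K p c s true) + finrank (ZMod p) (SelQP W K p c s false) = 1) :
    B.kappa 1 (∏ r ∈ s, (r : ℕ)) 0 ≠ 0 := by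
  have hK := hS.isImaginaryQuadratic
  obtain ⟨n₀, hn₀odd, hu₀, hn₀zero⟩ := exists_seed_of_hasUnitLambda c hB hS hloc hN h5 hsurj hH hsp hND hall hNV
  have ha : finrank (ZMod p) (SelQP W K p c n₀ true) + finrank (ZMod p) (SelQP W K p c n₀ false) ≤ 1 := by
    rw [hn₀zero true, hn₀zero false, finrank_bot]; omega
  have hpath := selQP_eqvGen_coreEdge_of_split_of_poitouTate W K p c h5 hsurj hK hH hsp hc1 hPT hodd ha hrank.le
  have hP := (propagate c hB hS hH hloc h5 hN hND hall hc1 hpath).mp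
    ⟨fun he ↦ absurd he (Nat.not_even_iff_odd.mpr hn₀odd), fun _ ↦ hu₀⟩
  exact hP.1 hs


/-- ★★★ **HOWARD'S THEOREM 3.2.3 (c) mod `𝔪` ON CELL β AS AN EQUIVALENCE at every definite vertex: given [NV], `λ_1(∏s)(0) ∈ ℤ_pˣ ⟺ s` is a ZERO
vertex (`SelQP W K p c s ⁺ = SelQP W K p c s ⁻ = 0`)** for every odd level `s`.  ⟹ is Howard's vanishing lemma (g28 `…AdmdefHowardVanishing`, (CTRL) :=
{HLV 3.7 local}, (RAM) := all-ramified) read through the zero-vertex dictionary (needs neither [NV] nor the PT fact); ⟸ is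
`isUnit_lam_of_hasUnitLambda_of_selQP_eq_bot`. [cite: Howard2006, Thm. 3.2.3 (c), Lem. 2.3.4] [cite: Howard2006Bipartite, Thm. 2.5.1] [cite: CastellaEtAl2025, Thm. 7.4, Thm. 7.5]
[cite: MilneADT2006, Ch. I, Thm. 4.10] [cite: HatleyLeiVigni2022, Lemma 3.7] -/
theorem isUnit_lam_iff_selQP_eq_bot_of_hasUnitLambda (hB : IsSignedBipartiteSystem W K p κ γ N ε B) (hS : Setting W K p κ 𝔭 𝔭')
    (hloc : hatleyLeiVigni2022_lemma37_local_signedCondition_eq_kummer W K p κ 𝔭 𝔭') (hPT : poitouTate_selmerStructure_duality K)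
    (hN : (N : ℤ) = W.conductorNorm ℤ) (h5 : 5 ≤ p) (hsurj : W.HasSurjectiveModNGaloisRep p)
    (hH : SatisfiesHeegnerHypothesis (W.conductorNorm ℤ) K) (hsp : ((Ideal.span {(p : ℤ)}).primesOver (𝓞 K)).ncard = 2)
    (hND : IsCoprime (N : ℤ) (NumberField.discr K))
    (hall : ∀ q : ℕ, q.Prime → q ∣ N → ∃ v' : HeightOneSpectrum (𝓞 ℚ), ((q : ℕ) : 𝓞 ℚ) ∈ v'.asIdeal ∧
      ∃ 𝔓 ∈ v'.primesAbove, ∃ σ ∈ 𝔓.inertia (absoluteGaloisGroup ℚ), ∃ P : W.geomTorsion (p : ℤ), σ • P ≠ P)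
    (hc1 : c ≠ 1) (hodd : Odd (finrank (ZMod p) (SelQP W K p c ∅ true) + finrank (ZMod p) (SelQP W K p c ∅ false)))
    (hNV : B.HasUnitLambda N) {s : Finset (AdmQ W K p)} (hs : Odd s.card) :
    IsUnit (PowerSeries.constantCoeff (B.lam 1 (∏ r ∈ s, (r : ℕ)))) ↔ ∀ μ : Bool, SelQP W K p c s μ = ⊥ := by
  refine ⟨fun hlam ↦ ?_, isUnit_lam_of_hasUnitLambda_of_selQP_eq_bot c hB hS hloc hPT hN h5 hsurj hH hsp hND hall hc1 hodd hNV hs⟩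
  refine selQP_eq_bot_of_forall_eq_zero W κ c hS hH hloc h5 hN hND hall ε ?_
  exact eq_zero_of_mem_signedOrdSelmerTorsion_of_isUnit_lam hB hN h5 hsurj hS.isImaginaryQuadratic hH hsp hS.anticyclotomic
    (ctrl_of_lemma37_local W κ hS hH hloc ε)
    (forall_exists_inertia_smul_ne_baseChange_of_allRamified W hS.isImaginaryQuadratic.1 hN hND hall) (prod_mem_defProducts_of_odd hN hs) hlam

/-- ★★★ **The anchor's vertices, binder shape of the line** (`(N : ℤ) = N_E`, `Surj`, Heegner as «every `ℓ ∣ N` split», (Par) DISCHARGED from the tree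
theorem Cassels–Tate and the named print fact Dokchitser–Dokchitser 2010 §4.6 step (4)): under `AcSigned.Setting`, {HLV 3.7 local}, the PT fact, the DD10
fact, `p ≥ 5`, `ρ̄` onto, (Heeg), `p` split, `(N, d_K) = 1`, binder (ii), `c ≠ 1` and [NV]: **at EVERY odd zero vertex `s` of the level-raised Selmer walk,
`λ_1(∏s)(0) ∈ ℤ_pˣ`.**  With the bridge (cites (15)–(16) of `Lines/admdef.lean`, `hdict`'s iff) this is K1's conclusion in λ-currency; conversely K1
gives [NV] through W. Zhang's walk (`exists_anchorLevel_of_definiteAnchor`) — so on cell β, K1 ⟺ [NV] modulo the named facts.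
[cite: Howard2006Bipartite, Thm. 2.5.1] [cite: Howard2006, Thm. 3.2.3 (c)] [cite: CastellaEtAl2025, Thm. 7.5, §7.4] [cite: DokchitserDokchitserAnnals2010, §4.6, Thm. 4.19]
[cite: MilneADT2006, Ch. I, Thm. 4.10] [cite: HatleyLeiVigni2022, Lemma 3.7] -/
theorem isUnit_lam_of_hasUnitLambda_of_selQP_eq_bot_of_dokchitser (hDD : dokchitser_selmerCorank_baseChange_mod_two_eq)
    (hPT : poitouTate_selmerStructure_duality K) (hB : IsSignedBipartiteSystem W K p κ γ N ε B) (hS : Setting W K p κ 𝔭 𝔭')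
    (hloc : hatleyLeiVigni2022_lemma37_local_signedCondition_eq_kummer W K p κ 𝔭 𝔭')
    (hN : (N : ℤ) = W.conductorNorm ℤ) (h5 : 5 ≤ p) (hsurj : Surj W p)
    (hHeeg : ∀ ℓ : ℕ, ℓ.Prime → ℓ ∣ N → ((Ideal.span {(ℓ : ℤ)}).primesOver (𝓞 K)).ncard = 2)
    (hsp : ((Ideal.span {(p : ℤ)}).primesOver (𝓞 K)).ncard = 2) (hND : IsCoprime (N : ℤ) (NumberField.discr K))
    (hall : ∀ q : ℕ, q.Prime → q ∣ N → ∃ v' : HeightOneSpectrum (𝓞 ℚ), ((q : ℕ) : 𝓞 ℚ) ∈ v'.asIdeal ∧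
      ∃ 𝔓 ∈ v'.primesAbove, ∃ σ ∈ 𝔓.inertia (absoluteGaloisGroup ℚ), ∃ P : W.geomTorsion (p : ℤ), σ • P ≠ P)
    (hc1 : c ≠ 1) (hNV : B.HasUnitLambda N)
    {s : Finset (AdmQ W K p)} (hs : Odd s.card) (hzero : ∀ μ : Bool, SelQP W K p c s μ = ⊥) :
    IsUnit (PowerSeries.constantCoeff (B.lam 1 (∏ r ∈ s, (r : ℕ)))) := by
  have hN' : N = W.conductorNorm ℤ := by exact_mod_cast hN
  have hH : SatisfiesHeegnerHypothesis (W.conductorNorm ℤ) K := fun ℓ hℓ hℓN ↦ hHeeg ℓ hℓ (hN' ▸ hℓN)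
  have hCT : ∀ (K : Type) [Field K] [NumberField K], WeierstrassCurve.exists_casselsTate_pairing (K := K) :=
    fun K _ _ ↦ GenusExact.CasselsTatePTcReal.exists_casselsTate_pairing_of_levelThetaDatum (K := K)
      fun V _ k hk _ e hμ hadd₁ hadd₂ _hgal halt _hnd =>
        ⟨levelThetaDatumEven V (2 ^ k) e hμ hadd₁ hadd₂ halt (Nat.even_pow.mpr ⟨even_two, hk.ne'⟩)⟩
  have hodd := SignedBaseChangeAcDivAdmdefOddSelmerDim.oddSelmerDim_of_casselsTate_of_dokchitser hCT hDD W K hN h5 hsurj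
    hS.isImaginaryQuadratic hHeeg c hc1
  exact isUnit_lam_of_hasUnitLambda_of_selQP_eq_bot c hB hS hloc hPT hN h5 hsurj hH hsp hND hall hc1 hodd hNV hs hzero

end Main

end Summit.BirchSwinnertonDyer.BirchSwinnertonDyer.Theorems.SignedBaseChangeAcDivAdmdefHowardRigidity

end
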